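import Summits.AtomisticToContinuum.HydrodynamicLimit.Theorems.MourreKoopmanChargesStressStrongMixingGibbsTranslation
import HarnessLib

/-!
# `StressStrongMixing` · line `birth`, stub Fcov `stub_equilibriumFlowShiftCovariant`, part 2:
# the conjugate flow `τ_{-v} ∘ Φ_t ∘ τ_v` and the stub from Alexander's uniqueness theorem

Support file for the crux item stmt-AtomisticToContinuum-9584 (`StressStrongMixing`, route
`MourreKoopmanCharges` of `AtomisticToContinuum/HydrodynamicLimit`), serving the registered stub
`stub_equilibriumFlowShiftCovariant` (Fcov) of the skeleton `Cruxes/StressStrongMixing/Lines/birth.lean`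
(the third input of `stressFramework_of`, the field `flow_comm_shift` of Spohn's `FluctuationDynamics`):

  `∀ σ > 0, ∀ Φ : InfiniteHardSphereFlow (Fin 3) σ, Φ.IsEquilibriumFlow → ∀ z β > 0, ∀ μ,`
  `IsHardSphereGibbs σ z β 0 μ → ∀ t x, Φ.flow t ∘ spatialShift x =ᵐ[μ] spatialShift x ∘ Φ.flow t`.

Proved here (`τ_v = PointConfig.translate v` for a phase-space vector `v = (a, 0)`, `v.2 = 0`):

1. **The conjugate flow** (every dimension `d`): `collisionEvents_translate`,
   `isInfiniteHardSphereTrajectory_translate` — the equations of motion of the infinite hard-sphere system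
   (hard core, continuity of positions, free flight, pairwise non-grazing elastic collisions from incoming
   left limits, local finiteness of collisions) are invariant under translating every position by `-a`
   and relabelling; `exists_conj_translate` — for an infinite hard-sphere flow `Φ` the maps
   `τ_{-v} ∘ Φ_t ∘ τ_v` on the good set `τ_v⁻¹(Φ.good)` with particle paths `Φ.traj (τ_v ω) (p + v) s - v`
   satisfy every axiom of `InfiniteHardSphereFlow`; `isEquilibriumFlow_conj_translate` — if `Φ` is an
   equilibrium flow (a.e. defined and stationary for every Gibbs state) so is its conjugate: apply the
   hypothesis to the Gibbs state `μ ∘ τ_v⁻¹` (part 1, `isHardSphereGibbs_map_translate`) and transport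
   back, `(Ψ_t)_* μ = (τ_{-v})_* (Φ_t)_* (τ_v)_* μ = μ`; `exists_equilibriumFlow_conj_spatialShift` — the
   same for `d = 3` and the shifts `spatialShift x` (registered helper).
2. **The stub, conditionally on Alexander's uniqueness theorem** (`equilibriumFlowShiftCovariant_of_unique`,
   registered helper): `InfiniteHardSphereFlow.unique (d := Fin 3)` (Alexander 1976 Cor. 5.4: two
   equilibrium flows agree for all times almost surely in every Gibbs state — a named, unproved fact of
   the tree) applied to `Φ` and its conjugate by `spatialShift x` gives `Φ_t = τ_{-x} ∘ Φ_t ∘ τ_x` `μ`-a.e.,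
   i.e. `Φ_t ∘ τ_x = τ_x ∘ Φ_t` `μ`-a.e.  Without uniqueness the stub is not a consequence of the
   structure: an `InfiniteHardSphereFlow` with `IsEquilibriumFlow` could a priori be a non-covariant
   measurable selection among non-unique solutions of the equations of motion.

References: R. Alexander, *Time evolution for infinitely many hard spheres*, Comm. Math. Phys. 49 (1976)
217–232, Thm 5.2, Thm 5.3, Cor 5.4; H. Spohn, *Large Scale Dynamics of Interacting Particles* (1991),
Part I §7.1.
-/

noncomputable section

open MeasureTheory ProbabilityTheory Filter Topology
open scoped InnerProductSpace ENNReal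

namespace Summit.AtomisticToContinuum.HydrodynamicLimit.Theorems.MourreKoopmanChargesStressStrongMixing

open Literature.MathematicalPhysics.KineticTheory Literature.Analysis.FluidPDE
open Literature.Analysis.FunctionSpaces (PointConfig)

/-! ### The conjugate of an infinite hard-sphere flow by a spatial translation -/

section ConjugateFlow

variable {d : Type*} [Fintype d] {ε : ℝ}

/-- The collision events of the translated, relabelled paths `p ↦ X_{p + v}(·) - v` (labels `p ∈ T`) are
those of `X` (labels in `T + v`) pulled back along `(p, t) ↦ (p + v, t)`: contacts only see position
differences. [folklore] -/
theorem collisionEvents_translate (ε : ℝ) (T : Set (EuclideanSpace ℝ d × EuclideanSpace ℝ d))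
    (x : EuclideanSpace ℝ d × EuclideanSpace ℝ d → ℝ → EuclideanSpace ℝ d × EuclideanSpace ℝ d)
    (v : EuclideanSpace ℝ d × EuclideanSpace ℝ d) :
    collisionEvents ε T (fun p s => x (p + v) s - v) =
      (fun e : (EuclideanSpace ℝ d × EuclideanSpace ℝ d) × ℝ => (e.1 + v, e.2)) ⁻¹'
        collisionEvents ε ((· + v) '' T) x := by
  ext ⟨p, t⟩
  simp only [mem_collisionEvents, Set.mem_preimage, (add_left_injective _).mem_set_image,
    Set.exists_mem_image, ne_eq, add_left_inj, Prod.fst_sub, sub_sub_sub_cancel_right]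

/-- **The equations of motion are translation invariant**: if the paths `X_q`, `q ∈ T + v`, form an
infinite hard-sphere trajectory and `v = (a, 0)`, so do the translated, relabelled paths
`p ↦ X_{p+v}(·) - v`, `p ∈ T` (hard core, continuity, free flight, pairwise non-grazing elastic
collisions and the local finiteness of collisions are all invariant under translating every position by
`-a`; velocities are unchanged since `v.2 = 0`). [folklore] -/
theorem isInfiniteHardSphereTrajectory_translate {T : Set (EuclideanSpace ℝ d × EuclideanSpace ℝ d)}
    {x : EuclideanSpace ℝ d × EuclideanSpace ℝ d → ℝ → EuclideanSpace ℝ d × EuclideanSpace ℝ d}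
    {v : EuclideanSpace ℝ d × EuclideanSpace ℝ d} (hv : v.2 = 0)
    (h : IsInfiniteHardSphereTrajectory ε ((· + v) '' T) x) :
    IsInfiniteHardSphereTrajectory ε T (fun p s => x (p + v) s - v) where
  hardCore t p hp q hq hpq := by
    have key := h.hardCore t (p + v) (Set.mem_image_of_mem _ hp) (q + v) (Set.mem_image_of_mem _ hq)
      (fun heq => hpq (add_right_cancel heq))
    simpa only [Prod.fst_sub, sub_sub_sub_cancel_right] using key
  locFinite r b c := by
    have hinj : Function.Injective
        fun e : (EuclideanSpace ℝ d × EuclideanSpace ℝ d) × ℝ => (e.1 + v, e.2) := by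
      intro e e' he
      simp only [Prod.mk.injEq, add_left_inj] at he
      exact Prod.ext he.1 he.2
    refine ((h.locFinite (r + ‖v.1‖) b c).preimage hinj.injOn).subset ?_
    rintro ⟨p, t⟩ ⟨hcoll, hr, ht⟩
    refine ⟨?_, ?_, ht⟩
    · rw [collisionEvents_translate] at hcoll
      exact hcoll
    · have hr' : ‖(x (p + v) t).1 - v.1‖ ≤ r := by simpa only [Prod.fst_sub] using hr
      calc ‖(x (p + v) t).1‖ = ‖((x (p + v) t).1 - v.1) + v.1‖ := by rw [sub_add_cancel]
        _ ≤ ‖(x (p + v) t).1 - v.1‖ + ‖v.1‖ := norm_add_le _ _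
        _ ≤ r + ‖v.1‖ := add_le_add hr' le_rfl
  pos_continuous p hp := by
    have hc : Continuous fun t => (x (p + v) t).1 - v.1 :=
      (h.pos_continuous (p + v) (Set.mem_image_of_mem _ hp)).sub continuous_const
    simpa only [Prod.fst_sub] using hc
  free p hp s t hst hfree := by
    have hfree' : ∀ τ ∈ Set.Ioc s t, (p + v, τ) ∉ collisionEvents ε ((· + v) '' T) x := by
      intro τ hτ hmem
      refine hfree τ hτ ?_
      rw [collisionEvents_translate]
      exact hmem
    have key := h.free (p + v) (Set.mem_image_of_mem _ hp) s t hst hfree'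
    show x (p + v) t - v = _
    rw [key]
    refine Prod.ext ?_ ?_
    · simp only [Prod.fst_sub, Prod.snd_sub, hv, sub_zero]
      abel
    · simp only [Prod.snd_sub, hv, sub_zero]
  binary p hp q hq hpq t hcontact := by
    have hsub : ∀ (q' : EuclideanSpace ℝ d × EuclideanSpace ℝ d) (s : ℝ),
        (x (p + v) s - v).1 - (x (q' + v) s - v).1 = (x (p + v) s).1 - (x (q' + v) s).1 :=
      fun q' s => by simp only [Prod.fst_sub, sub_sub_sub_cancel_right]
    have hcontact' : ‖(x (p + v) t).1 - (x (q + v) t).1‖ = ε := by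
      rw [← hsub]
      exact hcontact
    obtain ⟨huniq, vp, vq, hvp, hvq, hin, hout⟩ := h.binary (p + v) (Set.mem_image_of_mem _ hp)
      (q + v) (Set.mem_image_of_mem _ hq) (fun heq => hpq (add_right_cancel heq)) t hcontact'
    refine ⟨fun q' hq' hq'p hnorm => ?_, vp, vq, ?_, ?_, ?_, ?_⟩
    · have hnorm' : ‖(x (p + v) t).1 - (x (q' + v) t).1‖ = ε := by
        rw [← hsub]
        exact hnorm
      exact add_right_cancel (huniq (q' + v) (Set.mem_image_of_mem _ hq')
        (fun heq => hq'p (add_right_cancel heq)) hnorm')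
    · simpa only [Prod.snd_sub, hv, sub_zero] using hvp
    · simpa only [Prod.snd_sub, hv, sub_zero] using hvq
    · show ⟪(x (p + v) t - v).1 - (x (q + v) t - v).1, vp - vq⟫_ℝ < 0
      rw [hsub]
      exact hin
    · show (x (p + v) t - v).2 = (reflectVel ((x (p + v) t - v).1 - (x (q + v) t - v).1) (vp, vq)).1
      rw [hsub]
      simpa only [Prod.snd_sub, hv, sub_zero] using hout

/-- **The conjugate flow `τ_{-v} ∘ Φ_t ∘ τ_v`.** For an infinite hard-sphere flow `Φ` (diameter `ε`,
dimension `d`) and a phase-space translation `v = (a, 0)` there is an infinite hard-sphere flow `Ψ` with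
good set `τ_v⁻¹(Φ.good)`, time-`t` maps `Ψ_t = τ_{-v} ∘ Φ_t ∘ τ_v` and particle paths
`Ψ.traj ω p s = Φ.traj (τ_v ω) (p + v) s - v` (`τ_v = PointConfig.translate v`): every axiom of the
structure transports along the translation (`isInfiniteHardSphereTrajectory_translate` for the
equations of motion). [folklore] -/
theorem exists_conj_translate (Φ : InfiniteHardSphereFlow d ε)
    {v : EuclideanSpace ℝ d × EuclideanSpace ℝ d} (hv : v.2 = 0) :
    ∃ Ψ : InfiniteHardSphereFlow d ε,
      Ψ.good = PointConfig.translate v ⁻¹' Φ.good ∧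
      (∀ t, Ψ.flow t = PointConfig.translate (-v) ∘ Φ.flow t ∘ PointConfig.translate v) ∧
      ∀ ω p s, Ψ.traj ω p s = Φ.traj (PointConfig.translate v ω) (p + v) s - v := by
  refine ⟨{ flow := fun t => PointConfig.translate (-v) ∘ Φ.flow t ∘ PointConfig.translate v
            traj := fun ω p s => Φ.traj (PointConfig.translate v ω) (p + v) s - v
            good := PointConfig.translate v ⁻¹' Φ.good
            measurableSet_good := Φ.measurableSet_good.preimage (PointConfig.measurable_translate _)
            good_subset := fun ω hω => ?_
            measurable_flow := fun t => (PointConfig.measurable_translate _).comp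
              ((Φ.measurable_flow t).comp (PointConfig.measurable_translate _))
            flow_zero := fun ω hω => ?_
            flow_add := fun s t ω hω hωt => ?_
            traj_zero := fun ω hω p hp => ?_
            coe_flow := fun ω hω t => ?_
            traj_flow := fun s t ω hω hωt p hp => ?_
            isTrajectory := fun ω hω => ?_ }, rfl, fun t => rfl, fun ω p s => rfl⟩
  · -- good configurations are hard-sphere configurations
    have h := (Φ.good_subset hω).translate (-v)
    rwa [pointConfig_translate_neg_translate] at h
  · -- `Ψ_0 = id` on the good set
    show PointConfig.translate (-v) (Φ.flow 0 (PointConfig.translate v ω)) = ω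
    rw [Φ.flow_zero _ hω, pointConfig_translate_neg_translate]
  · -- the group law along good orbits
    have hωt' : Φ.flow t (PointConfig.translate v ω) ∈ Φ.good := by
      simpa only [Set.mem_preimage, Function.comp_apply, pointConfig_translate_translate_neg] using hωt
    show PointConfig.translate (-v) (Φ.flow (s + t) (PointConfig.translate v ω)) =
      PointConfig.translate (-v) (Φ.flow s (PointConfig.translate v
        (PointConfig.translate (-v) (Φ.flow t (PointConfig.translate v ω)))))
    rw [pointConfig_translate_translate_neg, Φ.flow_add s t _ hω hωt']
  · -- labels are the initial phase points
    show Φ.traj (PointConfig.translate v ω) (p + v) 0 - v = p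
    rw [Φ.traj_zero _ hω _ (show p + v ∈ (PointConfig.translate v ω).carrier from ⟨p, hp, rfl⟩),
      add_sub_cancel_right]
  · -- the evolved configuration is the set of evolved particles
    have hc := Φ.coe_flow _ hω t
    simp only [PointConfig.coe_eq_carrier, PointConfig.carrier_translate] at hc
    simp only [Function.comp_apply, PointConfig.coe_eq_carrier, PointConfig.carrier_translate, hc,
      Set.image_image, sub_eq_add_neg]
  · -- tracking is consistent with the group law
    have hωt' : Φ.flow t (PointConfig.translate v ω) ∈ Φ.good := by
      simpa only [Set.mem_preimage, Function.comp_apply, pointConfig_translate_translate_neg] using hωt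
    show Φ.traj (PointConfig.translate v
        ((PointConfig.translate (-v) ∘ Φ.flow t ∘ PointConfig.translate v) ω))
        (Φ.traj (PointConfig.translate v ω) (p + v) t - v + v) s - v =
      Φ.traj (PointConfig.translate v ω) (p + v) (s + t) - v
    rw [Function.comp_apply, Function.comp_apply, pointConfig_translate_translate_neg, sub_add_cancel,
      Φ.traj_flow s t _ hω hωt' _
        (show p + v ∈ (PointConfig.translate v ω).carrier from ⟨p, hp, rfl⟩)]
  · -- the particle paths solve the equations of motion
    have htraj := Φ.isTrajectory _ hω
    rw [PointConfig.coe_eq_carrier, PointConfig.carrier_translate] at htraj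
    exact isInfiniteHardSphereTrajectory_translate hv htraj

/-- **The conjugate of an equilibrium flow by a spatial translation is an equilibrium flow.** If
`Ψ_t = τ_{-v} ∘ Φ_t ∘ τ_v` with good set `τ_v⁻¹(Φ.good)`, `v = (a, 0)`, and `Φ` is a.e. defined and
stationary for every Gibbs state, so is `Ψ`: for a Gibbs state `μ`, apply the hypothesis on `Φ` to the
Gibbs state `μ ∘ τ_v⁻¹` (`isHardSphereGibbs_map_translate`) and transport back
(`(Ψ_t)_* μ = (τ_{-v})_* (Φ_t)_* (τ_v)_* μ = μ`). [folklore] -/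
theorem isEquilibriumFlow_conj_translate {Φ Ψ : InfiniteHardSphereFlow d ε} (hΦ : Φ.IsEquilibriumFlow)
    {v : EuclideanSpace ℝ d × EuclideanSpace ℝ d} (hv : v.2 = 0)
    (hgood : Ψ.good = PointConfig.translate v ⁻¹' Φ.good)
    (hflow : ∀ t, Ψ.flow t = PointConfig.translate (-v) ∘ Φ.flow t ∘ PointConfig.translate v) :
    Ψ.IsEquilibriumFlow := by
  intro z β hz hβ μ hμ
  obtain ⟨hae, hst⟩ := hΦ z β hz hβ _ (isHardSphereGibbs_map_translate hμ hv)
  refine ⟨?_, fun t => ?_⟩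
  · have h1 : ∀ᵐ ω ∂μ, PointConfig.translate v ω ∈ Φ.good :=
      (ae_map_iff (p := fun ω => ω ∈ Φ.good) (PointConfig.measurable_translate _).aemeasurable
        Φ.measurableSet_good).1 hae
    show ∀ᵐ ω ∂μ, ω ∈ Ψ.good
    rw [hgood]
    exact h1
  · rw [hflow t, ← Measure.map_map (PointConfig.measurable_translate _)
      ((Φ.measurable_flow t).comp (PointConfig.measurable_translate _)),
      ← Measure.map_map (Φ.measurable_flow t) (PointConfig.measurable_translate _), hst t,
      Measure.map_map (PointConfig.measurable_translate _) (PointConfig.measurable_translate _),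
      PointConfig.translate_neg_comp_translate, Measure.map_id]

end ConjugateFlow

/-! ### Dimension three: conjugation by the spatial shifts, and the stub from uniqueness -/

/-- `spatialShift (-x)` is translation by `-(x, 0)`. [folklore] -/
theorem spatialShift_neg_eq (x : V3) :
    (spatialShift (-x) : MarkedConfig → MarkedConfig) = PointConfig.translate (-((x, 0) : V3 × V3)) := by
  funext ω
  rw [spatialShift_apply, Prod.neg_mk, neg_zero]

/-- **Equilibrium flows are stable under conjugation by the spatial shifts** (`d = 3`): for every
equilibrium hard-sphere flow `Φ` and `x ∈ ℝ³` there is an equilibrium flow `Ψ` with good set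
`(spatialShift x)⁻¹(Φ.good)` and `Ψ_t = τ_{-x} ∘ Φ_t ∘ τ_x` for all `t` (`exists_conj_translate`,
`isEquilibriumFlow_conj_translate`). [folklore] -/
theorem exists_equilibriumFlow_conj_spatialShift :
    ∀ (σ : ℝ) (Φ : InfiniteHardSphereFlow (Fin 3) σ), Φ.IsEquilibriumFlow → ∀ x : V3,
      ∃ Ψ : InfiniteHardSphereFlow (Fin 3) σ, Ψ.IsEquilibriumFlow ∧
        Ψ.good = spatialShift x ⁻¹' Φ.good ∧
        ∀ t : ℝ, Ψ.flow t = spatialShift (-x) ∘ Φ.flow t ∘ spatialShift x := by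
  intro σ Φ hΦ x
  have hv : ((x, 0) : V3 × V3).2 = 0 := rfl
  obtain ⟨Ψ, hgood, hflow, -⟩ := exists_conj_translate Φ hv
  refine ⟨Ψ, isEquilibriumFlow_conj_translate hΦ hv hgood hflow, hgood, fun t => ?_⟩
  rw [hflow t, spatialShift_neg_eq]
  rfl

/-- **Stub Fcov from Alexander's uniqueness theorem.** Assuming `InfiniteHardSphereFlow.unique (d := Fin 3)`
(Alexander 1976 Cor. 5.4, BY NAME: two equilibrium flows of the hard-sphere gas agree for all times almost
surely in every Gibbs state), every equilibrium flow `Φ` commutes with the spatial shifts almost surely in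
every Gibbs state: compare `Φ` with its conjugate `τ_{-x} ∘ Φ_t ∘ τ_x`, an equilibrium flow by
`exists_equilibriumFlow_conj_spatialShift`, to get `Φ_t ω = τ_{-x} (Φ_t (τ_x ω))` for `μ`-a.e. `ω`, and apply
`τ_x`. This is the registered stub `stub_equilibriumFlowShiftCovariant` verbatim behind the single named
hypothesis. [folklore] -/
theorem equilibriumFlowShiftCovariant_of_unique :
    InfiniteHardSphereFlow.unique (d := Fin 3) →
    ∀ σ : ℝ, 0 < σ → ∀ Φ : InfiniteHardSphereFlow (Fin 3) σ, Φ.IsEquilibriumFlow →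
      ∀ z β : ℝ, 0 < z → 0 < β → ∀ μ : Measure MarkedConfig, IsHardSphereGibbs σ z β (0 : V3) μ →
        ∀ (t : ℝ) (x : V3), Φ.flow t ∘ spatialShift x =ᵐ[μ] spatialShift x ∘ Φ.flow t := by
  intro hU σ hσ Φ hΦ z β hz hβ μ hμ t x
  obtain ⟨Ψ, hΨ, -, hflow⟩ := exists_equilibriumFlow_conj_spatialShift σ Φ hΦ x
  have hae : ∀ᵐ ω ∂μ, ∀ t, Φ.flow t ω = Ψ.flow t ω := hU hσ Φ Ψ hΦ hΨ z β hz hβ μ hμ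
  filter_upwards [hae] with ω hω
  have key : spatialShift x (Φ.flow t ω) =
      spatialShift x ((spatialShift (-x) ∘ Φ.flow t ∘ spatialShift x) ω) := by
    rw [hω t, hflow t]
  rw [Function.comp_apply, Function.comp_apply, ← ShiftAction.apply_add, add_neg_cancel,
    ShiftAction.apply_zero] at key
  exact key.symm

end Summit.AtomisticToContinuum.HydrodynamicLimit.Theorems.MourreKoopmanChargesStressStrongMixing

end
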